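import Mathlib
import HarnessLib
import Summits.HubbardSuperconductivity.HubbardSuperconductivity.Theorems.KLProgrammeKLRegimeEnginePairTransferBaseScaleZero

/-!
# Route `KLProgramme` — ENGINE item stmt-HubbardSuperconductivity-20437 `KLRegimeEngineV17F2`, class #5 BASE, located item «SCALE0-MEMBER-DIFF» (pen (R494)(C)(iii)),
# PART 1a: ARITHMETIC of the order-3 profile and the GENERIC two-member difference — `klso_geom_*`, **`klso_inner_le`**, **`klso_outer_le`**, **`klso_vertexDiff_le`**
# (cell gate-hubbard-kl, seat hubbard-kl-k3c1-p1 g23, technique «composed-map remainder propagation»; scope memo SCALE0-MEMBER-DIFF-SCOPE.md)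

WHY.  Cure (β) of «(X).2′-BASE-ROOM» keeps the second-order term of the scale-0 member difference explicit and bounds only the remainder `R₃ = 𝒢₀ − T₁ − T₂`, whose pinned
kernel norms have the ORDER-3 PROFILE `ρ^{−2m′}·A·θ²·θ^{m′−4}` (degrees `≤ 6` from the order-3 tail, degrees `≥ 8` from the graded bound).  This file supplies the two
geometric resummations of that profile through the binomial–Gram sums (`klso_inner_le`: `Σ_{m″ ≥ m′} C(2m″,2m′)γ^{2m″−2m′}(…) ≤ 7·(2ρ⁻¹)^{2m′}Aθ²θ^{m′−4}` under
`4γ²θρ⁻² ≤ 1/2`, `4γ²ρ⁻² ≤ 2`; `klso_outer_le`: `Σ_{m′ ≥ 3} C(2m′,4)κD^{2m′−4}(…) ≤ 256·κD²(2ρ⁻¹)⁶A′` under `4κD²θ(2ρ⁻¹)² ≤ 1/2`, `4κD²(2ρ⁻¹)² ≤ 1`) and the member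
difference of the smeared quartic vertex of an ARBITRARY even grid element (`klso_vertexDiff_le`, = `klmg_vertexFn_map_gaussConv_sub_le_binomial₂` after
`softCovOf ψ₁ = softCovOf (ψ₁ − ψ₂) + softCovOf ψ₂`).  Consumer: `…PairTransferBaseSecondOrder` (`klso_memberDiff_sub_second_le_of_gridStep`).
Pure real arithmetic / one application of a landed lemma; nothing about the model is asserted; nothing asserts (X), any stub, K3 or superconductivity.  0 kit · 0 lit.
References: BGM 2006 (2.77)–(2.80) [cite: BenfattoGiulianiMastropietro2006].
-/

noncomputable section

namespace Summit.HubbardSuperconductivity.HubbardSuperconductivity.Theorems.KLRegimeSplit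

set_option linter.dupNamespace false -- summit = problem name (single-conjunct summit), D-0017

open Real Finset Matrix Set Literature.MathematicalPhysics.QuantumLattice Literature.Probability.LatticeModels GrassmannAlgebra
open Summit.HubbardSuperconductivity.HubbardSuperconductivity.Theorems.KLProgrammeLegKernels
open Summit.HubbardSuperconductivity.HubbardSuperconductivity.Theorems.DispersionFlow
open Summit.HubbardSuperconductivity.HubbardSuperconductivity.Theorems.KLRegimeWick
open Summit.HubbardSuperconductivity.HubbardSuperconductivity.Theorems.EngineV8
open Summit.HubbardSuperconductivity.HubbardSuperconductivity.Theorems.ScaleZeroDecay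

/-! ## §1 Arithmetic: the shifted geometric sums of the order-3 profile `ρ^{−2m′}·A·θ²·θ^{m′−4}` -/

section Arithmetic

/-- `Σ_{i<B} y^i ≤ 2` for `0 ≤ y ≤ 1/2`. -/
theorem klso_geom_two (B : ℕ) {y : ℝ} (hy0 : 0 ≤ y) (hy : y ≤ 1 / 2) : ∑ i ∈ range B, y ^ i ≤ 2 := by
  have hy1 : y < 1 := by linarith
  have h := geom_sum_Ico_le_of_lt_one (m := 0) (n := B) hy0 hy1
  rw [range_eq_Ico]
  refine h.trans ?_
  rw [pow_zero, div_le_iff₀ (by linarith)]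
  linarith

/-- `Σ_{k<B} y^{k−1} ≤ 3` for `0 ≤ y ≤ 1/2` (natural subtraction: the `k = 0` and `k = 1` terms are both `1`). -/
theorem klso_geom_shift_three (B : ℕ) {y : ℝ} (hy0 : 0 ≤ y) (hy : y ≤ 1 / 2) : ∑ k ∈ range B, y ^ (k - 1) ≤ 3 := by
  rcases Nat.eq_zero_or_pos B with rfl | hB
  · simp
  · obtain ⟨B', rfl⟩ : ∃ B', B = B' + 1 := ⟨B - 1, by omega⟩
    rw [sum_range_succ']
    simp only [Nat.add_sub_cancel, Nat.zero_sub, pow_zero]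
    have := klso_geom_two B' hy0 hy
    linarith

/-- `Σ_{k<B} c^k·θ^{k−1} ≤ 1 + 3c` for `c ≥ 0`, `θ ≥ 0`, `c·θ ≤ 1/2` (termwise `c^k θ^{k−1} ≤ [k = 0] + c·(cθ)^{k−1}`). -/
theorem klso_geom_shift (B : ℕ) {c θ : ℝ} (hc : 0 ≤ c) (hθ : 0 ≤ θ) (hcθ : c * θ ≤ 1 / 2) :
    ∑ k ∈ range B, c ^ k * θ ^ (k - 1) ≤ 1 + 3 * c := by
  have hy0 : 0 ≤ c * θ := mul_nonneg hc hθ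
  have hterm : ∀ k : ℕ, c ^ k * θ ^ (k - 1) ≤ (if k = 0 then (1 : ℝ) else 0) + c * (c * θ) ^ (k - 1) := by
    intro k
    rcases Nat.eq_zero_or_pos k with rfl | hk
    · simp; positivity
    · obtain ⟨j, rfl⟩ : ∃ j, k = j + 1 := ⟨k - 1, by omega⟩
      rw [if_neg (by omega), zero_add, show j + 1 - 1 = j by omega, pow_succ, mul_pow]
      nlinarith [pow_nonneg hc j, pow_nonneg hθ j, pow_nonneg hy0 j]
  refine (sum_le_sum fun k _ => hterm k).trans ?_
  rw [sum_add_distrib, ← mul_sum]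
  have h1 : ∑ k ∈ range B, (if k = 0 then (1 : ℝ) else 0) ≤ 1 := by
    rcases Nat.eq_zero_or_pos B with rfl | hB
    · simp
    · rw [sum_ite_eq' (range B) 0 (fun _ => (1 : ℝ))]; simp [hB]
  have h2 : ∑ k ∈ range B, (c * θ) ^ (k - 1) ≤ 3 := klso_geom_shift_three B hy0 hcθ
  nlinarith [mul_le_mul_of_nonneg_left h2 hc]

/-- **Inner resummation of the order-3 profile**: for `2 < m′`, `4γ²θρᵢ² ≤ 1/2`, `4γ²ρᵢ² ≤ 2`, `θ ≤ 1`,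
`Σ_{m″<B} [m′ ≤ m″]·C(2m″,2m′)·γ^{2m″−2m′}·(ρᵢ^{2m″}·A·θ²·θ^{m″−4}) ≤ 7·((2ρᵢ)^{2m′}·A·θ²·θ^{m′−4})` (`C(2m″,2m′) ≤ 4^{m″}`; `θ^{m′+k−4} ≤ θ^{m′−4}·θ^{k−1}`). -/
theorem klso_inner_le (B : ℕ) {γ θ ρi A : ℝ} (hγ : 0 ≤ γ) (hθ : 0 ≤ θ) (hθ1 : θ ≤ 1) (hρi : 0 ≤ ρi) (hA : 0 ≤ A)
    (hy : 4 * (γ ^ 2 * θ * ρi ^ 2) ≤ 1 / 2) (hg : 4 * (γ ^ 2 * ρi ^ 2) ≤ 2) {m' : ℕ} (hm' : 2 < m') :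
    ∑ m'' ∈ range B, (if m' ≤ m'' then ((2 * m'').choose (2 * m') : ℝ) * γ ^ (2 * m'' - 2 * m') * (ρi ^ (2 * m'') * A * θ ^ 2 * θ ^ (m'' - 4)) else 0) ≤
      7 * ((2 * ρi) ^ (2 * m') * A * θ ^ 2 * θ ^ (m' - 4)) := by
  set v : ℝ := 4 * (γ ^ 2 * ρi ^ 2) with hv_def
  have hv0 : 0 ≤ v := by positivity
  have hvθ : v * θ ≤ 1 / 2 := by rw [hv_def]; nlinarith
  set X : ℝ := (2 * ρi) ^ (2 * m') * A * θ ^ 2 * θ ^ (m' - 4) with hX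
  have hX0 : 0 ≤ X := by positivity
  have hterm : ∀ m'' : ℕ, (if m' ≤ m'' then ((2 * m'').choose (2 * m') : ℝ) * γ ^ (2 * m'' - 2 * m') * (ρi ^ (2 * m'') * A * θ ^ 2 * θ ^ (m'' - 4)) else 0) ≤
      X * (if m' ≤ m'' then v ^ (m'' - m') * θ ^ (m'' - m' - 1) else 0) := by
    intro m''
    split_ifs with hm
    · obtain ⟨k, rfl⟩ : ∃ k, m'' = m' + k := ⟨m'' - m', by omega⟩
      have hch : ((2 * (m' + k)).choose (2 * m') : ℝ) ≤ (4 : ℝ) ^ (m' + k) := by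
        have h := Nat.choose_le_two_pow (2 * (m' + k)) (2 * m')
        rw [pow_mul] at h
        exact_mod_cast h
      have hθpow : θ ^ (m' + k - 4) ≤ θ ^ (m' - 4) * θ ^ (k - 1) := by
        rw [← pow_add]
        exact pow_le_pow_of_le_one hθ hθ1 (by omega)
      have hrest : 0 ≤ γ ^ (2 * (m' + k) - 2 * m') * (ρi ^ (2 * (m' + k)) * A * θ ^ 2) := by positivity
      calc ((2 * (m' + k)).choose (2 * m') : ℝ) * γ ^ (2 * (m' + k) - 2 * m') * (ρi ^ (2 * (m' + k)) * A * θ ^ 2 * θ ^ (m' + k - 4))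
          = (((2 * (m' + k)).choose (2 * m') : ℝ) * (γ ^ (2 * (m' + k) - 2 * m') * (ρi ^ (2 * (m' + k)) * A * θ ^ 2))) * θ ^ (m' + k - 4) := by ring
        _ ≤ ((4 : ℝ) ^ (m' + k) * (γ ^ (2 * (m' + k) - 2 * m') * (ρi ^ (2 * (m' + k)) * A * θ ^ 2))) * (θ ^ (m' - 4) * θ ^ (k - 1)) :=
            mul_le_mul (mul_le_mul_of_nonneg_right hch hrest) hθpow (by positivity) (by positivity)
        _ = X * (v ^ (m' + k - m') * θ ^ (m' + k - m' - 1)) := by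
            rw [hX, hv_def, show 2 * (m' + k) - 2 * m' = 2 * k by omega, show m' + k - m' = k by omega,
              show 2 * (m' + k) = 2 * m' + 2 * k by ring]
            have h4 : (4 : ℝ) ^ (m' + k) = (2 ^ 2) ^ m' * 4 ^ k := by rw [pow_add]; norm_num
            rw [h4]
            simp only [pow_add, pow_mul, mul_pow]
            ring
    · exact le_of_eq (by simp)
  refine (sum_le_sum fun m'' _ => hterm m'').trans ?_
  rw [← mul_sum]
  have hgeo : ∑ m'' ∈ range B, (if m' ≤ m'' then v ^ (m'' - m') * θ ^ (m'' - m' - 1) else 0) ≤ 1 + 3 * v := by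
    rw [← Finset.sum_filter]
    have hset : (range B).filter (fun m'' => m' ≤ m'') = Finset.Ico m' B := by
      ext m''
      simp only [Finset.mem_filter, Finset.mem_range, Finset.mem_Ico]
      omega
    rw [hset]
    rcases le_or_gt m' B with hB | hB
    · rw [Finset.sum_Ico_eq_sum_range]
      simp only [show ∀ i : ℕ, m' + i - m' = i from fun i => by omega]
      exact klso_geom_shift _ hv0 hθ hvθ
    · rw [Finset.Ico_eq_empty (by omega), Finset.sum_empty]; positivity
  have h7 : 1 + 3 * v ≤ 7 := by linarith
  calc X * ∑ m'' ∈ range B, (if m' ≤ m'' then v ^ (m'' - m') * θ ^ (m'' - m' - 1) else 0) ≤ X * 7 :=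
        mul_le_mul_of_nonneg_left (hgeo.trans h7) hX0
    _ = 7 * ((2 * ρi) ^ (2 * m') * A * θ ^ 2 * θ ^ (m' - 4)) := by rw [hX]; ring

/-- **Outer resummation**: for `4κD²θ(2ρᵢ)² ≤ 1/2`, `4κD²(2ρᵢ)² ≤ 1`,
`Σ_{m′<B} [2 < m′]·C(2m′,4)·κD^{2m′−4}·((2ρᵢ)^{2m′}·A′·θ^{m′−4}) ≤ 4·(64·κD²·(2ρᵢ)⁶·A′)`. -/
theorem klso_outer_le (B : ℕ) {κD θ ρi A' : ℝ} (hκD : 0 ≤ κD) (hθ : 0 ≤ θ) (hρi : 0 ≤ ρi) (hA' : 0 ≤ A')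
    (hyD : 4 * (κD ^ 2 * θ * (2 * ρi) ^ 2) ≤ 1 / 2) (hu : 4 * (κD ^ 2 * (2 * ρi) ^ 2) ≤ 1) :
    ∑ m' ∈ range B, (if 2 < m' then ((2 * m').choose (2 * 2) : ℝ) * κD ^ (2 * m' - 2 * 2) * ((2 * ρi) ^ (2 * m') * A' * θ ^ (m' - 4)) else 0) ≤
      4 * (64 * κD ^ 2 * (2 * ρi) ^ 6 * A') := by
  set u : ℝ := 4 * (κD ^ 2 * (2 * ρi) ^ 2) with hu_def
  have hu0 : 0 ≤ u := by positivity
  have huθ : u * θ ≤ 1 / 2 := by rw [hu_def]; nlinarith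
  set Y : ℝ := 64 * κD ^ 2 * (2 * ρi) ^ 6 * A' with hY
  have hY0 : 0 ≤ Y := by positivity
  have hterm : ∀ m' : ℕ, (if 2 < m' then ((2 * m').choose (2 * 2) : ℝ) * κD ^ (2 * m' - 2 * 2) * ((2 * ρi) ^ (2 * m') * A' * θ ^ (m' - 4)) else 0) ≤
      Y * (if 2 < m' then u ^ (m' - 3) * θ ^ (m' - 3 - 1) else 0) := by
    intro m'
    split_ifs with hm
    · obtain ⟨i, rfl⟩ : ∃ i, m' = 3 + i := ⟨m' - 3, by omega⟩
      have hch : ((2 * (3 + i)).choose (2 * 2) : ℝ) ≤ (4 : ℝ) ^ (3 + i) := by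
        have h := Nat.choose_le_two_pow (2 * (3 + i)) (2 * 2)
        rw [pow_mul] at h
        exact_mod_cast h
      have hrest : 0 ≤ κD ^ (2 * (3 + i) - 2 * 2) * ((2 * ρi) ^ (2 * (3 + i)) * A' * θ ^ (3 + i - 4)) := by positivity
      calc ((2 * (3 + i)).choose (2 * 2) : ℝ) * κD ^ (2 * (3 + i) - 2 * 2) * ((2 * ρi) ^ (2 * (3 + i)) * A' * θ ^ (3 + i - 4))
          ≤ (4 : ℝ) ^ (3 + i) * (κD ^ (2 * (3 + i) - 2 * 2) * ((2 * ρi) ^ (2 * (3 + i)) * A' * θ ^ (3 + i - 4))) := by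
            rw [mul_assoc]; exact mul_le_mul_of_nonneg_right hch hrest
        _ = Y * (u ^ (3 + i - 3) * θ ^ (3 + i - 3 - 1)) := by
            rw [hY, hu_def, show 2 * (3 + i) - 2 * 2 = 2 + 2 * i by omega, show 3 + i - 4 = i - 1 by omega, show 3 + i - 3 = i by omega,
              show 2 * (3 + i) = 6 + 2 * i by ring]
            have h4 : (4 : ℝ) ^ (3 + i) = 64 * 4 ^ i := by rw [pow_add]; norm_num
            rw [h4]
            simp only [pow_add, pow_mul, mul_pow]
            ring
    · exact le_of_eq (by simp)
  refine (sum_le_sum fun m' _ => hterm m').trans ?_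
  rw [← mul_sum]
  have hgeo : ∑ m' ∈ range B, (if 2 < m' then u ^ (m' - 3) * θ ^ (m' - 3 - 1) else 0) ≤ 1 + 3 * u := by
    rw [← Finset.sum_filter]
    have hset : (range B).filter (fun m' => 2 < m') = Finset.Ico 3 B := by
      ext m'
      simp only [Finset.mem_filter, Finset.mem_range, Finset.mem_Ico]
      omega
    rw [hset]
    rcases le_or_gt 3 B with hB | hB
    · rw [Finset.sum_Ico_eq_sum_range]
      simp only [show ∀ i : ℕ, 3 + i - 3 = i from fun i => by omega]
      exact klso_geom_shift _ hu0 hθ huθ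
    · rw [Finset.Ico_eq_empty (by omega), Finset.sum_empty]; positivity
  have h4 : 1 + 3 * u ≤ 4 := by linarith
  calc Y * ∑ m' ∈ range B, (if 2 < m' then u ^ (m' - 3) * θ ^ (m' - 3 - 1) else 0) ≤ Y * 4 := mul_le_mul_of_nonneg_left (hgeo.trans h4) hY0
    _ = 4 * (64 * κD ^ 2 * (2 * ρi) ^ 6 * A') := by rw [hY]; ring

end Arithmetic

/-! ## §2 The member difference of an arbitrary even grid element (two members, two levels) -/

section Generic

variable {L M : ℕ} [NeZero L]

/-- The member difference of the smeared quartic vertex of ANY even grid element `G` with pinned kernel norms `Ng`: two-level binomial–Gram bound with the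
`D`-line's Gram constant `κD` (`Sᵀ·softCovOf K (ψ₁ − ψ₂)·S`) and member 2's `γ` (`Sᵀ·softCovOf K ψ₂·S`). -/
theorem klso_vertexDiff_le [NeZero M] {β : ℝ} (hβ : 0 < β) (μ : ℝ) (K : TrigPolyC4v) (ψ₁ ψ₂ : FreqMomentum L M → ℝ)
    {κD : ℝ} (hκD : 0 ≤ κD)
    (hGBD : IsGramBoundedR ((hubbardGridSub L M β (2 * (2 * M))).transpose * softCovOf L M β μ K (ψ₁ - ψ₂) * hubbardGridSub L M β (2 * (2 * M))) κD)
    {γ : ℝ} (hγ : 0 ≤ γ) (hGγ : IsGramBoundedR ((hubbardGridSub L M β (2 * (2 * M))).transpose * softCovOf L M β μ K ψ₂ * hubbardGridSub L M β (2 * (2 * M))) γ)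
    (G : GrassmannAlgebra ℂ (GridLeg (GridPoint L (2 * (2 * M))))) (hG : G ∈ evenPart ℂ (GridLeg (GridPoint L (2 * (2 * M)))))
    (Ng : ℕ → ℝ) (hN0 : ∀ m', 0 ≤ Ng m')
    (hN : ∀ m' (j : Fin (2 * m')) (w : GridLeg (GridPoint L (2 * (2 * M)))),
      ∑ Y ∈ univ.filter (fun Y : Fin (2 * m') → GridLeg (GridPoint L (2 * (2 * M))) => Y j = w), ‖kernel ℂ G (2 * m') Y‖ ≤ Ng m')
    (X : Fin 4 → HubbardFieldIdx L M) :
    ‖vertexFn L M β (ExteriorAlgebra.map (Matrix.toLin' (hubbardGridSub L M β (2 * (2 * M))))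
          (gaussConv ℂ ((hubbardGridSub L M β (2 * (2 * M))).transpose * softCovOf L M β μ K ψ₁ * hubbardGridSub L M β (2 * (2 * M))) G)) 4 X -
        vertexFn L M β (ExteriorAlgebra.map (Matrix.toLin' (hubbardGridSub L M β (2 * (2 * M))))
          (gaussConv ℂ ((hubbardGridSub L M β (2 * (2 * M))).transpose * softCovOf L M β μ K ψ₂ * hubbardGridSub L M β (2 * (2 * M))) G)) 4 X‖ ≤
      ((2 * 2).factorial : ℝ) / (β * (L : ℝ) ^ 2) * (Fintype.card (GridLeg (GridPoint L (2 * (2 * M)))) *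
        ∑ m' ∈ range (Fintype.card (GridLeg (GridPoint L (2 * (2 * M)))) / 2 + 1), if 2 < m' then ((2 * m').choose (2 * 2) : ℝ) * κD ^ (2 * m' - 2 * 2) *
          (∑ m'' ∈ range (Fintype.card (GridLeg (GridPoint L (2 * (2 * M)))) / 2 + 1), if m' ≤ m'' then ((2 * m'').choose (2 * m') : ℝ) * γ ^ (2 * m'' - 2 * m') * Ng m'' else 0)
          else 0) := by
  rw [klmf_softCovOf_eq_sub_add L M β μ K ψ₁ ψ₂, Matrix.mul_add, Matrix.add_mul]
  exact klmg_vertexFn_map_gaussConv_sub_le_binomial₂ L M β hβ _ hκD hGBD hγ hGγ G hG Ng hN0 hN (p := 2) (by norm_num) X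

end Generic

end Summit.HubbardSuperconductivity.HubbardSuperconductivity.Theorems.KLRegimeSplit

end
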